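import Literature.Geometry.Lorentzian.SenWittenOperator
import HarnessLib

/-!
# Frame calculus for the Sen–Witten connection: traces, divergences and the pairing current

Second brick of the analytic engine of Witten's proof of the positive energy theorem in the Pauli
model (`SenWittenOperator.lean`). In a smooth global `h`-orthonormal frame `F = (F₁, F₂, F₃)` of
the data manifold `(X, h, k)`:

* `SenWitten.trace_eq_sum_frame` — `tr L = Σᵢ h(L Fᵢ, Fᵢ)` for endomorphisms of `T_xX`;
* `SenWitten.vectorDivergence_frame` — `div Fᵢ = Σⱼ ω_{ij}(Fⱼ)`;
  `SenWitten.vectorDivergence_frameSum` — `div (Σ cᵢFᵢ) = Σᵢ (dcᵢ(Fᵢ) + cᵢ Σⱼ ω_{ij}(Fⱼ))`;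
* `SenWitten.spinConnForm_pauli_sub` — `A(v)σⱼ − σⱼA(v) = Σₖ ω_{jk}(v) σₖ` (Clifford
  multiplication by the frame is parallel);
* `SenWitten.val_leviCivita_pairingSum` — `h(∇ᵥ Σᵢ⟪α, σᵢβ⟫Fᵢ, Fⱼ) = ⟪∇ᵥα, σⱼβ⟫ + ⟪α, σⱼ∇ᵥβ⟫`,
  and `SenWitten.val_leviCivita_current` — `h(∇ᵥY_ψ, Fⱼ) = 2⟪σⱼψ, ∇ᵥψ⟫` for the current
  `Y_ψ = Σ⟪ψ, σⱼψ⟫Fⱼ`;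
* `SenWitten.vectorDivergence_pairingSum` — **`div (Σᵢ ⟪α, σᵢβ⟫ Fᵢ) = ⟪D̸α, β⟫ + ⟪α, D̸β⟫`**:
  the Riemannian Dirac operator of the frame is formally skew for the real inner product
  (Lawson–Michelsohn, Prop. II.5.3), the divergence identity behind the Lichnerowicz–Witten
  formula (Parker–Taubes 1982, (3.1)–(3.2)) and Witten's flux (ibid., (4.2)).

All proved; no definitions, no named facts.

## References

* T. Parker, C. H. Taubes, *On Witten's proof of the positive energy theorem*, Comm. Math. Phys.
  84 (1982) 223–238, §3. [ParkerTaubes1982]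
* R. Beig, P. T. Chruściel, *Killing vectors in asymptotically flat space-times. I*, J. Math.
  Phys. 37 (1996) 1939–1961, App. A, (A.10)–(A.11). [BeigChrusciel1996]
* B. O'Neill, *Semi-Riemannian geometry*, Academic Press 1983, Ch. 3, pp. 60–61, p. 86.
  [ONeill1983]
-/

noncomputable section

open Bundle Set Function Manifold Finset Filter
open scoped Manifold ContDiff Topology RealInnerProductSpace

namespace Literature.Geometry.Lorentzian

namespace SenWitten

open PauliModel

variable {X : Type*} [TopologicalSpace X] [ChartedSpace E3 X] [IsManifold (𝓡 3) ∞ X]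
  (D : InitialDataSet (𝓡 3) X) (F : Fin 3 → Π x : X, TangentSpace (𝓡 3) x)

/-! ### Frame calculus -/

section FrameCalculus

variable [D.metric.HasLeviCivita]

omit [D.metric.HasLeviCivita] in
/-- **Trace in an orthonormal frame**: `tr L = Σᵢ h(L Fᵢ, Fᵢ)` for an endomorphism `L` of
`T_xX` (an orthonormal triad is a basis of the three-dimensional tangent space, with coordinate
functionals `h(·, Fᵢ)`). O'Neill 1983, Ch. 3, pp. 60–61. [cite: ONeill1983, Ch. 3, pp. 60–61] -/
theorem trace_eq_sum_frame {x : X}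
    (horth : ∀ i j, D.h.inner x (F i x) (F j x) = if i = j then 1 else 0)
    (L : TangentSpace (𝓡 3) x →ₗ[ℝ] TangentSpace (𝓡 3) x) :
    LinearMap.trace ℝ (TangentSpace (𝓡 3) x) L = ∑ i, D.h.inner x (L (F i x)) (F i x) := by
  have hli : LinearIndependent ℝ (fun i ↦ F i x) := by
    rw [Fintype.linearIndependent_iff]
    intro c hc i
    have h := congrArg (fun w ↦ D.h.inner x w (F i x)) hc
    simp only [map_sum, map_smul, _root_.sum_apply, FunLike.coe_smul, Pi.smul_apply,
      smul_eq_mul, horth, mul_ite, mul_one, mul_zero, Finset.sum_ite_eq', Finset.mem_univ,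
      if_true, map_zero, _root_.zero_apply] at h
    exact h
  have hcard : Fintype.card (Fin 3) = Module.finrank ℝ (TangentSpace (𝓡 3) x) := by
    show Fintype.card (Fin 3) = Module.finrank ℝ E3
    rw [finrank_euclideanSpace_fin, Fintype.card_fin]
  set b := basisOfLinearIndependentOfCardEqFinrank hli hcard with hbdef
  have hb : ∀ i, b i = F i x := fun i ↦
    congrFun (coe_basisOfLinearIndependentOfCardEqFinrank hli hcard) i
  have hcoord : ∀ i, b.coord i = (D.h.inner x (F i x) : TangentSpace (𝓡 3) x →ₗ[ℝ] ℝ) := by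
    intro i
    refine b.ext fun j ↦ ?_
    rw [Module.Basis.coord_apply, b.repr_self, Finsupp.single_apply, hb]
    simp only [ContinuousLinearMap.coe_coe, horth]
    by_cases hij : i = j
    · subst hij; simp
    · rw [if_neg (Ne.symm hij), if_neg hij]
  rw [LinearMap.trace_eq_matrix_trace ℝ b, Matrix.trace]
  refine Finset.sum_congr rfl fun i _ ↦ ?_
  rw [Matrix.diag_apply, LinearMap.toMatrix_apply, ← Module.Basis.coord_apply, hcoord i, hb i]
  simp only [ContinuousLinearMap.coe_coe]
  exact D.h.symm x _ _

/-- **Divergence of a frame field**: `div Fᵢ = Σⱼ ω_{ij}(Fⱼ)` (`div = tr ∇`, trace in the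
orthonormal frame). O'Neill 1983, Ch. 3, p. 86. [cite: ONeill1983, Ch. 3, p. 86] -/
theorem vectorDivergence_frame {x : X}
    (horth : ∀ i j, D.h.inner x (F i x) (F j x) = if i = j then 1 else 0) (i : Fin 3) :
    D.metric.vectorDivergence (F i) x = ∑ j, connCoeff D F i j x (F j x) := by
  rw [PseudoRiemannianMetric.vectorDivergence_def, trace_eq_sum_frame D F horth]
  rfl

/-- **Divergence of a frame expansion**: for coefficients `cᵢ` differentiable at `x`,
`div (Σᵢ cᵢFᵢ) = Σᵢ (dcᵢ(Fᵢ) + cᵢ Σⱼ ω_{ij}(Fⱼ))`. O'Neill 1983, Ch. 3, p. 86 (Leibniz rule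
`div(uY) = u div Y + du(Y)`). [cite: ONeill1983, Ch. 3, p. 86] -/
theorem vectorDivergence_frameSum
    (hF : ∀ i x, MDifferentiableAt (𝓡 3) ((𝓡 3).prod 𝓘(ℝ, E3))
      (fun y ↦ (TotalSpace.mk' E3 y (F i y) : TangentBundle (𝓡 3) X)) x)
    {x : X} (horth : ∀ i j, D.h.inner x (F i x) (F j x) = if i = j then 1 else 0)
    {c : Fin 3 → X → ℝ} (hc : ∀ i, MDifferentiableAt (𝓡 3) 𝓘(ℝ, ℝ) (c i) x) :
    D.metric.vectorDivergence (fun y ↦ ∑ i, c i y • F i y) x =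
      ∑ i, (mvfderiv (𝓡 3) (c i) x (F i x) + c i x * ∑ j, connCoeff D F i j x (F j x)) := by
  have hsum : (fun y ↦ ∑ i, c i y • F i y) = ∑ i, (c i • F i) := by
    funext y
    simp only [Finset.sum_apply, Pi.smul_apply']
  have hs : ∀ i, MDifferentiableAt (𝓡 3) ((𝓡 3).prod 𝓘(ℝ, E3))
      (fun y ↦ (TotalSpace.mk' E3 y ((c i • F i) y) : TangentBundle (𝓡 3) X)) x := fun i ↦
    (hc i).smul_section (hF i x)
  rw [hsum, (PseudoRiemannianMetric.vectorDivergence_finset_sum (g := D.metric) Finset.univ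
    (Y := fun i ↦ c i • F i) (fun i _ ↦ hs i)).2]
  refine Finset.sum_congr rfl fun i _ ↦ ?_
  rw [PseudoRiemannianMetric.vectorDivergence_smul (hF i x) (hc i), vectorDivergence_frame D F horth]
  ring

/-- **The spin connection form commutes with the Pauli operators up to a Clifford vector**:
`A(v)(σⱼu) − σⱼ(A(v)u) = Σₖ ω_{jk}(v) σₖu` for an orthonormal frame — the trivialised form of
`∇ᵥ(Fⱼ·ψ) = (∇ᵥFⱼ)·ψ + Fⱼ·∇ᵥψ` (`[σₖσₗ, σⱼ] = 2δₗⱼσₖ − 2δⱼₖσₗ`). Beig–Chruściel 1996, App. A,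
(A.10)–(A.11.0). [cite: BeigChrusciel1996, App. A, (A.10)–(A.11.0)] -/
theorem spinConnForm_pauli_sub
    (hF : ∀ i x, MDifferentiableAt (𝓡 3) ((𝓡 3).prod 𝓘(ℝ, E3))
      (fun y ↦ (TotalSpace.mk' E3 y (F i y) : TangentBundle (𝓡 3) X)) x)
    (horth : ∀ x i j, D.h.inner x (F i x) (F j x) = if i = j then 1 else 0)
    (x : X) (v : TangentSpace (𝓡 3) x) (j : Fin 3) (u : Spinor) :
    spinConnForm D F x v (pauli j u) - pauli j (spinConnForm D F x v u) =
      ∑ k, connCoeff D F j k x v • pauli k u := by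
  have hanti : ∀ i j, connCoeff D F i j x v = -connCoeff D F j i x v := fun i j ↦
    SenParallel.val_leviCivita_frame_antisymm D hF horth x v i j
  have hdiag : ∀ i, connCoeff D F i i x v = 0 := fun i ↦ by linarith [hanti i i]
  have h10 := hanti 1 0
  have h20 := hanti 2 0
  have h21 := hanti 2 1
  have hsq := pauli_sq
  have ha01 := pauli_anticomm (show (0 : Fin 3) ≠ 1 by decide)
  have ha02 := pauli_anticomm (show (0 : Fin 3) ≠ 2 by decide)
  have ha12 := pauli_anticomm (show (1 : Fin 3) ≠ 2 by decide)
  fin_cases j <;>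
  · simp only [spinConnForm_apply, Fin.sum_univ_three, hdiag, h10, h20, h21, zero_smul, zero_add,
      add_zero, map_neg, map_add, map_smul, smul_add, smul_neg, neg_smul, hsq, ha01, ha02, ha12,
      neg_neg, Fin.zero_eta, Fin.mk_one, Fin.reduceFinMk]
    module

/-- **Covariant derivative of the current-type vector `Σᵢ ⟪α, σᵢβ⟫ Fᵢ`, paired with the
frame**: `h(∇ᵥ Σᵢ ⟪α, σᵢβ⟫ Fᵢ, Fⱼ) = ⟪∇ᵥα, σⱼβ⟫ + ⟪α, σⱼ∇ᵥβ⟫` (the spin connection is metric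
and Clifford multiplication is parallel). For `α = β = ψ`: `h(∇ᵥY_ψ, Fⱼ) = 2⟪σⱼψ, ∇ᵥψ⟫`.
Beig–Chruściel 1996, App. A, (A.11). [cite: BeigChrusciel1996, App. A, (A.11)] -/
theorem val_leviCivita_pairingSum
    (hF : ∀ i x, MDifferentiableAt (𝓡 3) ((𝓡 3).prod 𝓘(ℝ, E3))
      (fun y ↦ (TotalSpace.mk' E3 y (F i y) : TangentBundle (𝓡 3) X)) x)
    (horth : ∀ x i j, D.h.inner x (F i x) (F j x) = if i = j then 1 else 0)
    {α β : X → Spinor} {x : X} (hα : MDifferentiableAt (𝓡 3) 𝓘(ℝ, Spinor) α x)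
    (hβ : MDifferentiableAt (𝓡 3) 𝓘(ℝ, Spinor) β x) (v : TangentSpace (𝓡 3) x) (j : Fin 3) :
    D.metric.val x (D.metric.leviCivita (fun y ↦ ∑ i, ⟪α y, pauli i (β y)⟫ • F i y) x v) (F j x) =
      ⟪spinCovDeriv D F α x v, pauli j (β x)⟫ + ⟪α x, pauli j (spinCovDeriv D F β x v)⟫ := by
  have hc : ∀ i, MDifferentiableAt (𝓡 3) 𝓘(ℝ, ℝ) (fun y ↦ ⟪α y, pauli i (β y)⟫) x := fun i ↦
    SenParallel.mdifferentiableAt_real_inner hα (SenParallel.mdifferentiableAt_clm_apply_comp _ hβ)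
  rw [SenParallel.val_leviCivita_frameSum D hF horth hc v j,
    SenParallel.mvfderiv_real_inner hα (SenParallel.mdifferentiableAt_clm_apply_comp _ hβ),
    SenParallel.mvfderiv_clm_apply_comp _ hβ]
  -- the connection terms: `⟪Aα, σⱼβ⟫ + ⟪α, σⱼAβ⟫ = −⟪α, [A, σⱼ]β⟫ = −Σₖ ω_{jk} ⟪α, σₖβ⟫`
  have hskew := inner_spinConnForm_left D F hF horth x v
  have hcomm := spinConnForm_pauli_sub D F hF horth x v j (β x)
  have hanti : ∀ i, connCoeff D F i j x v = -connCoeff D F j i x v := fun i ↦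
    SenParallel.val_leviCivita_frame_antisymm D hF horth x v i j
  simp only [spinCovDeriv_apply, inner_add_left, inner_add_right, map_add]
  have key : ⟪spinConnForm D F x v (α x), pauli j (β x)⟫ + ⟪α x, pauli j (spinConnForm D F x v (β x))⟫
      = ∑ i, ⟪α x, pauli i (β x)⟫ * connCoeff D F i j x v := by
    rw [hskew]
    have e1 : -⟪α x, spinConnForm D F x v (pauli j (β x))⟫ +
        ⟪α x, pauli j (spinConnForm D F x v (β x))⟫ =
        -⟪α x, spinConnForm D F x v (pauli j (β x)) - pauli j (spinConnForm D F x v (β x))⟫ := by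
      rw [inner_sub_right]; ring
    rw [e1, hcomm, inner_sum, ← Finset.sum_neg_distrib]
    refine Finset.sum_congr rfl fun k _ ↦ ?_
    rw [inner_smul_right, hanti k]
    ring
  simp only [connCoeff_apply] at key ⊢
  linarith [key]

/-- **Divergence of the pairing current** (the spin Dirac operator is formally skew):
`div (Σᵢ ⟪α, σᵢβ⟫ Fᵢ) = ⟪D̸α, β⟫ + ⟪α, D̸β⟫`. Lawson–Michelsohn, *Spin Geometry*, Prop. II.5.3;
Parker–Taubes 1982, §3. [cite: ParkerTaubes1982, §3] -/
theorem vectorDivergence_pairingSum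
    (hF : ∀ i x, MDifferentiableAt (𝓡 3) ((𝓡 3).prod 𝓘(ℝ, E3))
      (fun y ↦ (TotalSpace.mk' E3 y (F i y) : TangentBundle (𝓡 3) X)) x)
    (horth : ∀ x i j, D.h.inner x (F i x) (F j x) = if i = j then 1 else 0)
    {α β : X → Spinor} {x : X} (hα : MDifferentiableAt (𝓡 3) 𝓘(ℝ, Spinor) α x)
    (hβ : MDifferentiableAt (𝓡 3) 𝓘(ℝ, Spinor) β x) :
    D.metric.vectorDivergence (fun y ↦ ∑ i, ⟪α y, pauli i (β y)⟫ • F i y) x =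
      ⟪dirac D F α x, β x⟫ + ⟪α x, dirac D F β x⟫ := by
  rw [PseudoRiemannianMetric.vectorDivergence_def, trace_eq_sum_frame D F (horth x)]
  simp only [ContinuousLinearMap.coe_coe]
  have h := fun j ↦ val_leviCivita_pairingSum D F hF horth hα hβ (F j x) j
  simp only [D.val_metric] at h
  simp only [h, dirac_apply, sum_inner, inner_sum, pauli_symm, Finset.sum_add_distrib]

/-- **Covariant derivative of the current**: `h(∇ᵥY_ψ, Fⱼ) = 2⟪σⱼψ, ∇ᵥψ⟫`.
Beig–Chruściel 1996, App. A, (A.11). [cite: BeigChrusciel1996, App. A, (A.11)] -/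
theorem val_leviCivita_current
    (hF : ∀ i x, MDifferentiableAt (𝓡 3) ((𝓡 3).prod 𝓘(ℝ, E3))
      (fun y ↦ (TotalSpace.mk' E3 y (F i y) : TangentBundle (𝓡 3) X)) x)
    (horth : ∀ x i j, D.h.inner x (F i x) (F j x) = if i = j then 1 else 0)
    {ψ : X → Spinor} {x : X} (hψ : MDifferentiableAt (𝓡 3) 𝓘(ℝ, Spinor) ψ x)
    (v : TangentSpace (𝓡 3) x) (j : Fin 3) :
    D.metric.val x (D.metric.leviCivita (current F ψ) x v) (F j x) =
      2 * ⟪pauli j (ψ x), spinCovDeriv D F ψ x v⟫ := by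
  have h := val_leviCivita_pairingSum D F hF horth hψ hψ v j
  have hcur : current F ψ = fun y ↦ ∑ i, ⟪ψ y, pauli i (ψ y)⟫ • F i y := rfl
  rw [hcur, h, real_inner_comm (pauli j (ψ x)), pauli_symm]
  ring

end FrameCalculus

end SenWitten

end Literature.Geometry.Lorentzian

end
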